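import Summits.QuantumFields.YangMills.Theorems.FluctuationComparisonRegPrIntLS2BetaCurlBudgetAbs
import Summits.QuantumFields.YangMills.Theorems.FluctuationComparisonRegPrIntLS2BetaCurlBudgetOfChartTower
import Summits.QuantumFields.YangMills.Theorems.FluctuationComparisonRegPrIntLS2BetaCoarseCurlRowsRem
import Summits.QuantumFields.YangMills.Theorems.FluctuationComparisonRegPrIntLS2BetaChartReadDescentOntoExpPoint
import Literature.MathematicalPhysics.QuantumFieldTheory.Balaban1983to89.T4ExpWindowSmallField
import Literature.MathematicalPhysics.QuantumFieldTheory.Balaban1983to89.B10Eq18SigmaSU2Window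
import HarnessLib

/-!
# S2β · (SCT″-c)₁ G4-ii — «THE LINEARISED LADDER AND THE JUNCTION OUTSIDE IT» (ARCHITECT RULING «SRC-VOL» 2026-08-31T23:30:47Z: quadratic remainders may NOT ride as
# fine-site sources of the curl ladder — they are priced in READ-SUP currency as window-small `S′`-shares).  Successor edition of ✓p836340 G4-i: the ladder family is
# `ρ :=` the GROUP size at level `0` (JNC-0) and the LINEARISED curl `‖Y_{Ū^nU₀}(∂q)[X̂_n]‖` at every level `n ≥ 1` — NO BCH remainder inside; the sources are M-1‴'s `src`
# (plaquette-class × chord, class (a) of «SRC-VOL») + `4R` + the ONE `0 → 1` junction term; the c₁ TEXT is then bounded by TWICE the ladder's read energies plus TWICE the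
# READ-SUP of the BCH remainder `e^S − 1 − S` (file `…CurlBudgetJunctionSplit`), which the assembler prices as `β_junc·S′` with `β_junc ∝ M̄²` (window constants, «FB-σ»)

Cell `ym3-torus` (YM ladder rung R3 = continuum `SU(2)` Yang–Mills on the three-torus at fixed lattice data — a RUNG: NOT d = 4, NOT infinite volume, NOT a mass gap,
NOT Clay).  Width seat «width 10» `ym3-torus-px10` (gen 26); crux `stmt-QuantumFields-20520`, LINE g18-1 S2β; G4-ii (px17 g23 «GO NOW»).
`--kind proof --supports stmt-QuantumFields-20520 --as helper`, count-neutral, DEFINITION-FREE (0 `def`, 0 `instance`, 0 `notation`, 0 `sorry`, default heartbeats).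

WHAT IS PROVED (sorry-free).  In `…CurlBudgetOfChartTowerSup`: ★★★`linBudget_of_chartTower` — at FIXED data, with the quaternionic chart tower `X` (`hXdef`, consumer passes `rfl`):
from (T) (window `1∕4`), M-1‴'s classes `α δ αp` (+ signs), corner sizes `M`, free remainder `R`, and the source ENERGY in ROW form
`Σ_{i<K−J} w(i+1)·L^{K−J−1−(i+1)}·Σ_μΣ_νΣ_{y′}(𝟙[μ<ν]·(src_{M-1‴}(i+1,y′) + 𝟙[i=0]·|Idx|⁻¹Σ_a rem(0,pos_a y′)))² ≤ Bsrc` (NO `rem(i+1)` term any more):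
**`Σ_{t<K−J} L^t·(Cst·Σ_B ‖𝟙_read·ρ_{K−J−1−t}‖²) ≤ (2·Cst·κ²νC_b)·(4·L⁻¹·(L^{K−J}·REL) + W·Bsrc)`** (✓`curlBudget_core_abs` at `g := ρ`; rows = M-1‴ for `i ≥ 1`
verbatim, the `0 → 1` step through the mirror junction).  In `…CurlBudgetJunctionSplit`: ★`sq_le_two_sq_add_two_sq_of_le_add`; ★★`dist_le_rho_add_rem` (group size ≤ `ρ` + `rem`, all levels);
★★★`c1_le_two_lin_add_two_rem`: **`Σ_t L^t·c₁(t) ≤ 2·Σ_t L^t·(Cst·Σ_B ‖𝟙_read·ρ‖²) + 2·Σ_t L^t·(Cst·Σ_B ‖𝟙_read·rem‖²)`** — the second summand is the junction in READ-SUP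
currency (`rem_n(x) ≤ 16·Mg n·(Σ of the four chart norms)` under (T), so it is `≤ 512·Cst·M̄²·Σ_t L^t Σ_B ‖𝟙_read·‖X‖‖²`: a cover of `E′` and a window-small `β`).
SOURCE CLASSES («SRC-VOL», architect px17 g23 2026-08-31T23:42:13Z).  `hBsrc` is a FINE-SITE ℓ² energy — forced by the only engine on the tree (✓`weighted_readMax_sq_le_sources`:
read-max output, fine-site data and sources, Schur dilution per level).  It is K-uniformly inhabitable EXACTLY for sources whose coefficients DECAY like plaquette classes:
the binders `hα` (loops of the BACKGROUND tower `Ū^iU₀`), `hUs` (`PlaqSmall (δ(i+1)) (Ū^iU₀)`), `hαp` (coarse plaquettes of `avgFun … (Ū^iU₀)`) are BACKGROUND-tower classes —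
BKG-class (`∝ C_B·α·L^{2i−2(K−J)}`) under the station's (BKG) binder ⇒ the `δ·M`, `α·M`, `αp·M` terms of `src` and `R`'s `δM²` piece are affordable (pure purse); `R`'s
CHORD-class pieces (`κM²`, `Ō·M`, `Ō²` of (β-3)′) are NOT affordable as fine-site sources unless re-read as plaquette-class × chord (HAZARD-candidate «SRC-VOL-R»); the `0 → 1`
junction term is affordable iff the finest relative chord is lattice-spacing small ((SUP-DECAY)₀).
DOMAIN LINE (architect px17 g23, RULING «SRC-VOL (3)» 2026-08-31T23:46:52Z): `hBsrc`'s `4R` summand is inhabitable K-uniformly only for the plaquette×chord² piece `δM²`;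
the `κM²`, `Ō·M`, `Ō²` pieces are HAZARD «SRC-VOL-R» (open).
WHAT IS LEFT by name: (T) (w4's (b)); (SRC-LIN) = the energy of M-1‴'s LINEAR sources from (BKG) + ONE (L2-TOWER) letter (px12 first refusal); `R`'s class ((β-3)′ must be
re-read as plaquette-class × chord — px13); the `0 → 1` junction's energy carries `Mg 0²·L^{2(K−J)+2}` (pure purse iff the finest relative chord is lattice-spacing small —
(SUP-DECAY)₀, px12∕px21); the junction share's cover constant `C_cov` (px21).

HONEST SCOPE.  Identification + re-plumbing over LANDED letters (M-1‴ ✓p835604, junctions ✓p832898∕✓p833305, core ✓p835744, O's shape ✓p835698, lit chart lemmas); nothing of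
Bałaban's renormalisation-group analysis is asserted or proved ([Balaban1985Averaging] (19)–(20) p.21, (56)–(58) p.27, Prop. 4 (128)–(135) pp.37–38; [Balaban1987RG1] (0.1)–(0.4),
(0.8), (0.11) pp.251–253 are the printed rows these letters transcribe); (T), the classes, the sizes `M`, the letter `R`, the source ENERGY (SRC), the doors (α)(β)(γ), (iii),
the SUPPLIER KNIT, (ST⁗)∕LOC⁗, h3 are HYPOTHESES or others'; GAP♯∘ (`stub_uniformFibreGapOrbit`, registry `Lines/semiclassical_s2beta.lean` 3732b7df UNTOUCHED, 0∕5), S2β, the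
five registered stubs, crux 20520, 19936, 19200 and `YM3TorusSU2` are NOT proved; no registered stub is closed; rung R3 = SU(2) YM₃ on T³ at fixed lattice data — NOT d = 4, NOT
infinite volume, NOT a mass gap, NOT Clay; the Yang–Mills mass gap is NOT proved.
-/

set_option autoImplicit false

noncomputable section

open scoped Matrix.Norms.L2Operator
open Finset

namespace Summit.QuantumFields.YangMills.Theorems.FluctuationComparisonRegPrIntLS2BetaCurlBudgetOfChartTowerSup

open Literature.MathematicalPhysics.QuantumFieldTheory.Balaban1983to89
open Literature.MathematicalPhysics.QuantumFieldTheory.Balaban1983to89.T4Continuum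
open Literature.MathematicalPhysics.QuantumFieldTheory.Balaban1983to89.T3ContinuumYM3Torus
open Literature.MathematicalPhysics.QuantumFieldTheory.Balaban1983to89.T3LevelShift
open Literature.MathematicalPhysics.QuantumFieldTheory.Balaban1983to89.T3UnitLawDensityEML (ℰp)
open Literature.MathematicalPhysics.QuantumFieldTheory.Balaban1983to89.T4HaarSU2ExpChart (expPoint)
open Literature.MathematicalPhysics.QuantumFieldTheory.Balaban1983to89.T4ExpWindowSmallField (logVec expPoint_logVec)
open Literature.MathematicalPhysics.QuantumFieldTheory.Balaban1983to89.HaarExponentialChart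
open Literature.MathematicalPhysics.QuantumFieldTheory.Balaban1983to89.HaarExponentialChart.IsChartRep
open Literature.MathematicalPhysics.QuantumFieldTheory.Balaban1983to89.BlockAveraging (Idx blockAvg avgFun loopHol blockAvg_avg)
open Literature.MathematicalPhysics.QuantumFieldTheory.Balaban1983to89.ExpMeanLog (expMeanLogSU deltaSU)
open Literature.MathematicalPhysics.QuantumFieldTheory.Balaban1983to89.BlockAveragingEMLLinearisedBackground (covWalkSum)
open Literature.MathematicalPhysics.QuantumFieldTheory.Balaban1983to89.B10Eq47AxialChi (shiftN)
open Literature.MathematicalPhysics.QuantumFieldTheory.Balaban1983to89.B14.Eq22Determines (blockIter)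
open Literature.MathematicalPhysics.QuantumFieldTheory.Balaban1983to89.B10Eq27TorusAxialLog (rel)
open Literature.MathematicalPhysics.QuantumFieldTheory.Balaban1983to89.B10Eq18SigmaSU2 (su2Coord)
open Literature.MathematicalPhysics.QuantumFieldTheory.Balaban1983to89.B10Eq18SigmaSU2Haar (rev norm_rev)
open Literature.MathematicalPhysics.QuantumFieldTheory.Balaban1983to89.B10Eq18SigmaSU2Window (norm_su2Coord)
open Literature.MathematicalPhysics.QuantumLattice (su2Quat)
open Summit.QuantumFields.YangMills.Theorems.FluctuationComparisonRegPrIntLS2BetaChartReadDescentOntoExpPoint (su2Coord_rev_mem_lie expPoint_eq_expChart)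
open Summit.QuantumFields.YangMills.Theorems.FluctuationComparisonRegPrIntLS2BetaCurlBudgetAbs (curlBudget_core_abs)
open Summit.QuantumFields.YangMills.Theorems.FluctuationComparisonRegPrIntLS2BetaCurlBudgetOfChartTower (eq_expChart_logVecChart_mul logVecChart_eq_logChart srcM_nonneg)
open Summit.QuantumFields.YangMills.Theorems.FluctuationComparisonRegPrIntLS2BetaCurlBudgetEngine (kernelConst_nonneg)
open Summit.QuantumFields.YangMills.Theorems.FluctuationComparisonRegPrIntLS2BetaCoarseCurlRowsRem (rows_LL_tower_of_remainder_K5)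
open Summit.QuantumFields.YangMills.Theorems.FluctuationComparisonRegPrIntLS2BetaRelPlaqCurlJunction (dist1_relPlaq_le_curl_add_rem norm_curl_le_dist1_relPlaq_add_rem)
open Summit.QuantumFields.YangMills.Theorems.FluctuationComparisonRegPrIntLS2BetaSupTowerTerm (pi_norm_le_of_pointwise)

variable (F : T3Family)


/-! ## §1 The linearised ladder on the chart tower -/

/-- ★★★ **THE LINEARISED LADDER ON THE CHART TOWER** — see the module header: `ρ :=` GROUP size at level 0, the LINEARISED curl at every level `≥ 1` (NO remainder
inside); ✓`curlBudget_core_abs` at `g := ρ`; sources = M-1‴'s `src` + the ONE `0 → 1` junction term.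
[cite: Balaban1985Averaging, (19)-(20) p.21, (58) p.27, Prop. 4 (128)-(135) pp.37-38; Balaban1987RG1, (0.1)-(0.4), (0.8), (0.11) pp.251-253] -/
theorem linBudget_of_chartTower {J K : ℕ} (hJK : J ≤ K) (θr : ℕ) (Cst : ℝ) (hCst : 0 ≤ Cst)
    (U₀ : GaugeField (F.P K) 0 (Matrix.specialUnitaryGroup (Fin 2) ℂ)) (ζ : PBond (F.P K) 0 → EuclideanSpace ℝ (Fin 3))
    (w : ℕ → ℝ) (hw : ∀ j, 0 < w j) (W : ℝ) (hW : ∀ n, ∑ j ∈ Finset.Icc 1 n, (w j)⁻¹ ≤ W)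
    (X : (i : ℕ) → PBond (F.P K) i → (specialUnitaryLogChart (Fin 2)).lie)
    (hXdef : X = fun (i : ℕ) (b : PBond (F.P K) i) =>
      (⟨su2Coord (rev (logVec (su2Quat (Averaging.iter (fun k => BlockAveraging.blockAvg (P := F.P K) (j := k) ℰp) i (fun ℓ => expPoint (ζ ℓ) * U₀ ℓ : GaugeField (F.P K) 0 (Matrix.specialUnitaryGroup (Fin 2) ℂ)) b * (Averaging.iter (fun k => BlockAveraging.blockAvg (P := F.P K) (j := k) ℰp) i U₀ b)⁻¹)))), su2Coord_rev_mem_lie _⟩ : (specialUnitaryLogChart (Fin 2)).lie))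
    (Mg : ℕ → ℝ) (hMg : ∀ t, t ≤ K - J → ∀ b : PBond (F.P K) t,
      ‖logVec (su2Quat (Averaging.iter (fun k => BlockAveraging.blockAvg (P := F.P K) (j := k) ℰp) t (fun ℓ => expPoint (ζ ℓ) * U₀ ℓ : GaugeField (F.P K) 0 (Matrix.specialUnitaryGroup (Fin 2) ℂ)) b * (Averaging.iter (fun k => BlockAveraging.blockAvg (P := F.P K) (j := k) ℰp) t U₀ b)⁻¹))‖ ≤ Mg t)
    (hMg4 : ∀ t, t ≤ K - J → Mg t ≤ 1 / 4)
    (α δ : ℕ → ℝ) (αp : Fin (F.P K).d → Fin (F.P K).d → ℕ → ℝ)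
    (hα : ∀ i, i < K - J → ∀ (c : PBond (F.P K) (i + 1)) (ι : Idx (F.P K)), dist1 (loopHol (Averaging.iter (fun k => BlockAveraging.blockAvg (P := F.P K) (j := k) ℰp) i U₀) c ι) ≤ α (i + 1))
    (hα24 : ∀ i, i < K - J → α (i + 1) ≤ 1 / 24) (hαδ : ∀ i, i < K - J → α (i + 1) < deltaSU (Fin 2))
    (hα0 : ∀ i, 0 ≤ α i) (hδ : ∀ i, i < K - J → 0 ≤ δ (i + 1)) (hUs : ∀ i, i < K - J → PlaqSmall (δ (i + 1)) (Averaging.iter (fun k => BlockAveraging.blockAvg (P := F.P K) (j := k) ℰp) i U₀))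
    (hαp0 : ∀ μ ν i, 0 ≤ αp μ ν i)
    (hαp : ∀ μ ν : Fin (F.P K).d, μ < ν → ∀ i, i < K - J → ∀ y' : Site (F.P K) (i + 1),
      dist1 (holAt (avgFun (expMeanLogSU (n := Fin 2)) (Averaging.iter (fun k => BlockAveraging.blockAvg (P := F.P K) (j := k) ℰp) i U₀)) (walk y' [((μ, true) : Letter (F.P K).d), (ν, true), (μ, false), (ν, false)])) ≤ αp μ ν (i + 1))
    (M : Fin (F.P K).d → Fin (F.P K).d → (i : ℕ) → Site (F.P K) i → ℝ) (hM : ∀ μ ν i x, 0 ≤ M μ ν i x)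
    (hXM : ∀ μ ν : Fin (F.P K).d, μ < ν → ∀ i, i < K - J → ∀ (y' : Site (F.P K) (i + 1)) (b : PBond (F.P K) i),
      (blockOf b.src = y' ∨ blockOf b.src = y'.shift μ ∨ blockOf b.src = y'.shift ν ∨ blockOf b.src = (y'.shift μ).shift ν) → ‖X i b‖ ≤ M μ ν (i + 1) y')
    (R : Fin (F.P K).d → Fin (F.P K).d → (i : ℕ) → Site (F.P K) i → ℝ) (hR0 : ∀ μ ν i x, 0 ≤ R μ ν i x)
    (hR : ∀ μ ν : Fin (F.P K).d, μ < ν → ∀ i, i < K - J → ∀ (y' : Site (F.P K) (i + 1)) (c : PBond (F.P K) (i + 1)),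
      (c = ⟨y', μ⟩ ∨ c = ⟨y'.shift μ, ν⟩ ∨ c = ⟨y'.shift ν, μ⟩ ∨ c = ⟨y', ν⟩) →
      ‖(((isChartRep_specialUnitaryGroup (n := Fin 2)).logChart (avgFun (expMeanLogSU (n := Fin 2)) (fun b => (isChartRep_specialUnitaryGroup (n := Fin 2)).expChart (X i b) * Averaging.iter (fun k => BlockAveraging.blockAvg (P := F.P K) (j := k) ℰp) i U₀ b) c * (avgFun (expMeanLogSU (n := Fin 2)) (Averaging.iter (fun k => BlockAveraging.blockAvg (P := F.P K) (j := k) ℰp) i U₀) c)⁻¹) : (specialUnitaryLogChart (Fin 2)).lie) : Matrix (Fin 2) (Fin 2) ℂ) -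
        ((fderiv ℝ (fun (A : PBond (F.P K) i → (specialUnitaryLogChart (Fin 2)).lie) (c : PBond (F.P K) (i + 1)) => (isChartRep_specialUnitaryGroup (n := Fin 2)).logChart (avgFun (expMeanLogSU (n := Fin 2)) (fun b => (isChartRep_specialUnitaryGroup (n := Fin 2)).expChart (A b) * Averaging.iter (fun k => BlockAveraging.blockAvg (P := F.P K) (j := k) ℰp) i U₀ b) c * (avgFun (expMeanLogSU (n := Fin 2)) (Averaging.iter (fun k => BlockAveraging.blockAvg (P := F.P K) (j := k) ℰp) i U₀) c)⁻¹)) 0 (X i) c : (specialUnitaryLogChart (Fin 2)).lie) : Matrix (Fin 2) (Fin 2) ℂ)‖ ≤ R μ ν (i + 1) y')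
    (Bsrc : ℝ)
    (hBsrc : ∑ i ∈ Finset.range (K - J), w (i + 1) * (F.L : ℝ) ^ (K - J - 1 - (i + 1)) *
        ∑ μ : Fin (F.P K).d, ∑ ν : Fin (F.P K).d, ∑ y' : Site (F.P K) (i + 1),
          (if μ < ν then
          (((F.P K).L : ℝ) * (((F.P K).L : ℝ) * (2 * δ (i + 1) * (((F.P K).L : ℝ) + 2 * (F.P K).L + 2) * M μ ν (i + 1) y')) + 48 * α (i + 1) * (((F.P K).L : ℝ) * M μ ν (i + 1) y') +
            (2 * αp μ ν (i + 1) * (((((F.P K).d + 2) * (F.P K).L : ℕ) : ℝ) * M μ ν (i + 1) y') + 24 * α (i + 1) * (((((F.P K).d + 2) * (F.P K).L : ℕ) : ℝ) * M μ ν (i + 1) y')) +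
            4 * (404 * ((((F.P K).d + 2) * (F.P K).L : ℕ) : ℝ) * α (i + 1) * M μ ν (i + 1) y') + 4 * R μ ν (i + 1) y' +
            2 * δ (i + 1) * (((F.P K).L : ℝ) ^ 2 * M μ ν (i + 1) y')) +
          (if i = 0 then ((Fintype.card (Idx (F.P K)) : ℝ)⁻¹ *
            ∑ a ∈ (Finset.univ : Finset (Idx (F.P K))) ×ˢ (Finset.range (F.P K).L ×ˢ Finset.range (F.P K).L),
              (Real.exp (‖X i ⟨(shiftN (shiftN (Site.blockSite y' a.1.1) μ a.2.1) ν a.2.2), μ⟩‖ + ‖X i ⟨((shiftN (shiftN (Site.blockSite y' a.1.1) μ a.2.1) ν a.2.2)).shift μ, ν⟩‖ + ‖X i ⟨((shiftN (shiftN (Site.blockSite y' a.1.1) μ a.2.1) ν a.2.2)).shift ν, μ⟩‖ + ‖X i ⟨(shiftN (shiftN (Site.blockSite y' a.1.1) μ a.2.1) ν a.2.2), ν⟩‖) - 1 - (‖X i ⟨(shiftN (shiftN (Site.blockSite y' a.1.1) μ a.2.1) ν a.2.2), μ⟩‖ + ‖X i ⟨((shiftN (shiftN (Site.blockSite y' a.1.1)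 μ a.2.1) ν a.2.2)).shift μ, ν⟩‖ + ‖X i ⟨((shiftN (shiftN (Site.blockSite y' a.1.1) μ a.2.1) ν a.2.2)).shift ν, μ⟩‖ + ‖X i ⟨(shiftN (shiftN (Site.blockSite y' a.1.1) μ a.2.1) ν a.2.2), ν⟩‖))) else 0)
          else 0) ^ 2 ≤ Bsrc) :
    ∑ t ∈ Finset.range (K - J), (F.L : ℝ) ^ t * (fun t => Cst * ∑ B : PBond (F.P J) 0,
      ‖(fun p : Plaq (F.P K) (K - J - 1 - t) =>
        if ∃ z₀ : Site (F.P K) 0, (blockIter (K - J) z₀ = (bondShift (F.sitesPerDir_eq (m := F.m) (K := J) (j := 0) (m' := F.m) (K' := K) (j' := K - J) (by omega)) B).src ∨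
            blockIter (K - J) z₀ = (bondShift (F.sitesPerDir_eq (m := F.m) (K := J) (j := 0) (m' := F.m) (K' := K) (j' := K - J) (by omega)) B).tgt) ∧
            ∀ κ, (rel (blockIter (K - J - 1 - t) z₀) p.src κ).natAbs ≤ θr
        then (fun (μ ν : Fin (F.P K).d) (i : ℕ) (x : Site (F.P K) i) =>
      (if h : μ < ν then (if i = 0 then dist1 ((GaugeField.plaqHol (Averaging.iter (fun k => BlockAveraging.blockAvg (P := F.P K) (j := k) ℰp) i U₀) ⟨x, μ, ν, h⟩)⁻¹ *
          GaugeField.plaqHol (Averaging.iter (fun k => BlockAveraging.blockAvg (P := F.P K) (j := k) ℰp) i (fun ℓ => expPoint (ζ ℓ) * U₀ ℓ : GaugeField (F.P K) 0 (Matrix.specialUnitaryGroup (Fin 2) ℂ))) ⟨x, μ, ν, h⟩) else ‖covWalkSum (Averaging.iter (fun k => BlockAveraging.blockAvg (P := F.P K) (j := k) ℰp) i U₀) (fun b => ((X i b : (specialUnitaryLogChart (Fin 2)).lie) : Matrix (Fin 2) (Fin 2) ℂ))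
          (walk x [((μ, true) : Letter (F.P K).d), (ν, true), (μ, false), (ν, false)])‖) else 0)) p.μ p.ν (K - J - 1 - t) p.src
        else 0)‖ ^ 2) t ≤
      (2 * Cst * (((5 ^ (F.P K).d : ℕ) : ℝ) ^ 2 * (((2 * (θr + 2) + 1) ^ (F.P K).d * 6 : ℕ) : ℝ) *
              (2 * ((((F.P K).L ^ (F.P K).d : ℕ) : ℝ) - 1) / ((((F.P K).L ^ (F.P K).d : ℕ) : ℝ) - 3)))) * (4 * (F.L : ℝ)⁻¹ * ((F.L : ℝ) ^ (K - J) * ∑ p : Plaq (F.P K) 0,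
                  (1 - reTr ((GaugeField.plaqHol U₀ p)⁻¹ * GaugeField.plaqHol (fun ℓ => expPoint (ζ ℓ) * U₀ ℓ : GaugeField (F.P K) 0 (Matrix.specialUnitaryGroup (Fin 2) ℂ)) p))) + W * Bsrc) := by
  have hm : K - J ≤ (F.P K).m + (F.P K).K := by show K - J ≤ F.m + K; omega
  -- (1) the quaternionic chart tower: Ū^n(e^ζU₀) = Θ(X_n)·Ū^n U₀ (GLOBAL), and M-1‴'s recursion (on the window `M ≤ 1∕4`)
  have hstage : ∀ n, Averaging.iter (fun k => BlockAveraging.blockAvg (P := F.P K) (j := k) ℰp) n (fun ℓ => expPoint (ζ ℓ) * U₀ ℓ : GaugeField (F.P K) 0 (Matrix.specialUnitaryGroup (Fin 2) ℂ)) =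
      fun c => (isChartRep_specialUnitaryGroup (n := Fin 2)).expChart (X n c) * Averaging.iter (fun k => BlockAveraging.blockAvg (P := F.P K) (j := k) ℰp) n U₀ c := by
    intro n
    rw [hXdef]
    exact eq_expChart_logVecChart_mul (Averaging.iter (fun k => BlockAveraging.blockAvg (P := F.P K) (j := k) ℰp) n (fun ℓ => expPoint (ζ ℓ) * U₀ ℓ : GaugeField (F.P K) 0 (Matrix.specialUnitaryGroup (Fin 2) ℂ))) (Averaging.iter (fun k => BlockAveraging.blockAvg (P := F.P K) (j := k) ℰp) n U₀)
  have hU : ∀ i, i < K - J → (fun i => Averaging.iter (fun k => BlockAveraging.blockAvg (P := F.P K) (j := k) ℰp) i U₀) (i + 1) =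
      avgFun (expMeanLogSU (n := Fin 2)) ((fun i => Averaging.iter (fun k => BlockAveraging.blockAvg (P := F.P K) (j := k) ℰp) i U₀) i) := fun i _ => rfl
  have hXrec : ∀ i, i < K - J → X (i + 1) = fun c : PBond (F.P K) (i + 1) => (isChartRep_specialUnitaryGroup (n := Fin 2)).logChart
      (avgFun (expMeanLogSU (n := Fin 2)) (fun b => (isChartRep_specialUnitaryGroup (n := Fin 2)).expChart (X i b) * (fun i => Averaging.iter (fun k => BlockAveraging.blockAvg (P := F.P K) (j := k) ℰp) i U₀) i b) c *
        (avgFun (expMeanLogSU (n := Fin 2)) ((fun i => Averaging.iter (fun k => BlockAveraging.blockAvg (P := F.P K) (j := k) ℰp) i U₀) i) c)⁻¹) := by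
    intro i hi
    funext c
    have e0 : (fun b => (isChartRep_specialUnitaryGroup (n := Fin 2)).expChart (X i b) * (fun i => Averaging.iter (fun k => BlockAveraging.blockAvg (P := F.P K) (j := k) ℰp) i U₀) i b) = Averaging.iter (fun k => BlockAveraging.blockAvg (P := F.P K) (j := k) ℰp) i (fun ℓ => expPoint (ζ ℓ) * U₀ ℓ : GaugeField (F.P K) 0 (Matrix.specialUnitaryGroup (Fin 2) ℂ)) := (hstage i).symm
    rw [e0]
    have e1 : avgFun (expMeanLogSU (n := Fin 2)) (Averaging.iter (fun k => BlockAveraging.blockAvg (P := F.P K) (j := k) ℰp) i (fun ℓ => expPoint (ζ ℓ) * U₀ ℓ : GaugeField (F.P K) 0 (Matrix.specialUnitaryGroup (Fin 2) ℂ))) c * (avgFun (expMeanLogSU (n := Fin 2)) ((fun i => Averaging.iter (fun k => BlockAveraging.blockAvg (P := F.P K) (j := k) ℰp) i U₀) i) c)⁻¹ =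
        Averaging.iter (fun k => BlockAveraging.blockAvg (P := F.P K) (j := k) ℰp) (i + 1) (fun ℓ => expPoint (ζ ℓ) * U₀ ℓ : GaugeField (F.P K) 0 (Matrix.specialUnitaryGroup (Fin 2) ℂ)) c * (Averaging.iter (fun k => BlockAveraging.blockAvg (P := F.P K) (j := k) ℰp) (i + 1) U₀ c)⁻¹ := rfl
    rw [e1, ← logVecChart_eq_logChart _ ((hMg (i + 1) (by omega) c).trans (hMg4 (i + 1) (by omega))), hXdef]
  -- (2) M-1‴'s rows for the linearised curl, per orientation
  have hrowlin : ∀ μ ν : Fin (F.P K).d, μ < ν → ∀ i, i < K - J → ∀ y' : Site (F.P K) (i + 1),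
      ‖covWalkSum (Averaging.iter (fun k => BlockAveraging.blockAvg (P := F.P K) (j := k) ℰp) (i + 1) U₀) (fun b => ((X (i + 1) b : (specialUnitaryLogChart (Fin 2)).lie) : Matrix (Fin 2) (Fin 2) ℂ))
          (walk y' [((μ, true) : Letter (F.P K).d), (ν, true), (μ, false), (ν, false)])‖ ≤
        ((Fintype.card (Idx (F.P K)) : ℝ)⁻¹ *
            ∑ a ∈ (Finset.univ : Finset (Idx (F.P K))) ×ˢ (Finset.range (F.P K).L ×ˢ Finset.range (F.P K).L),
              ‖covWalkSum (Averaging.iter (fun k => BlockAveraging.blockAvg (P := F.P K) (j := k) ℰp) i U₀) (fun b => ((X i b : (specialUnitaryLogChart (Fin 2)).lie) : Matrix (Fin 2) (Fin 2) ℂ))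
          (walk (shiftN (shiftN (Site.blockSite y' a.1.1) μ a.2.1) ν a.2.2) [((μ, true) : Letter (F.P K).d), (ν, true), (μ, false), (ν, false)])‖) +
          (((F.P K).L : ℝ) * (((F.P K).L : ℝ) * (2 * δ (i + 1) * (((F.P K).L : ℝ) + 2 * (F.P K).L + 2) * M μ ν (i + 1) y')) + 48 * α (i + 1) * (((F.P K).L : ℝ) * M μ ν (i + 1) y') +
            (2 * αp μ ν (i + 1) * (((((F.P K).d + 2) * (F.P K).L : ℕ) : ℝ) * M μ ν (i + 1) y') + 24 * α (i + 1) * (((((F.P K).d + 2) * (F.P K).L : ℕ) : ℝ) * M μ ν (i + 1) y')) +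
            4 * (404 * ((((F.P K).d + 2) * (F.P K).L : ℕ) : ℝ) * α (i + 1) * M μ ν (i + 1) y') + 4 * R μ ν (i + 1) y' +
            2 * δ (i + 1) * (((F.P K).L : ℝ) ^ 2 * M μ ν (i + 1) y')) := by
    intro μ ν hμν
    exact rows_LL_tower_of_remainder_K5 (P := F.P K) (N := 2) (ne_of_lt hμν) (K - J) hm (fun i => Averaging.iter (fun k => BlockAveraging.blockAvg (P := F.P K) (j := k) ℰp) i U₀) X hU hXrec
      α δ (αp μ ν) hα hα24 hαδ hδ hUs (hαp μ ν hμν) (M μ ν) (fun i _ y' => hM μ ν (i + 1) y') (hXM μ ν hμν) (R μ ν) (hR μ ν hμν) _ _ rfl rfl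
  -- (3) the remainders are nonnegative
  have hrem : ∀ s : ℝ, 0 ≤ Real.exp s - 1 - s := fun s => by linarith [Real.add_one_le_exp s]
  -- (4) the core's five letters for ρ := [level 0: GROUP size; level ≥ 1: linearised curl + BCH remainder]
  have hρ0 : ∀ (μ ν : Fin (F.P K).d) (i : ℕ) (x : Site (F.P K) i), (0 : ℝ) ≤ (fun (μ ν : Fin (F.P K).d) (i : ℕ) (x : Site (F.P K) i) =>
      (if h : μ < ν then (if i = 0 then dist1 ((GaugeField.plaqHol (Averaging.iter (fun k => BlockAveraging.blockAvg (P := F.P K) (j := k) ℰp) i U₀) ⟨x, μ, ν, h⟩)⁻¹ *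
          GaugeField.plaqHol (Averaging.iter (fun k => BlockAveraging.blockAvg (P := F.P K) (j := k) ℰp) i (fun ℓ => expPoint (ζ ℓ) * U₀ ℓ : GaugeField (F.P K) 0 (Matrix.specialUnitaryGroup (Fin 2) ℂ))) ⟨x, μ, ν, h⟩) else ‖covWalkSum (Averaging.iter (fun k => BlockAveraging.blockAvg (P := F.P K) (j := k) ℰp) i U₀) (fun b => ((X i b : (specialUnitaryLogChart (Fin 2)).lie) : Matrix (Fin 2) (Fin 2) ℂ))
          (walk x [((μ, true) : Letter (F.P K).d), (ν, true), (μ, false), (ν, false)])‖) else 0)) μ ν i x := by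
    intro μ ν i x
    beta_reduce
    split_ifs
    · exact GaugeGroup.dist1_nonneg _
    · exact norm_nonneg _
    · exact le_rfl
  have hsrc0 : ∀ (μ ν : Fin (F.P K).d) (i : ℕ) (x : Site (F.P K) i), (0 : ℝ) ≤ (fun (μ ν : Fin (F.P K).d) (i : ℕ) =>
      match i with
        | 0 => fun (_ : Site (F.P K) 0) => (0 : ℝ)
        | i' + 1 => fun (y' : Site (F.P K) (i' + 1)) => if i' < K - J then (if μ < ν then
          (((F.P K).L : ℝ) * (((F.P K).L : ℝ) * (2 * δ (i' + 1) * (((F.P K).L : ℝ) + 2 * (F.P K).L + 2) * M μ ν (i' + 1) y')) + 48 * α (i' + 1) * (((F.P K).L : ℝ) * M μ ν (i' + 1) y') +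
            (2 * αp μ ν (i' + 1) * (((((F.P K).d + 2) * (F.P K).L : ℕ) : ℝ) * M μ ν (i' + 1) y') + 24 * α (i' + 1) * (((((F.P K).d + 2) * (F.P K).L : ℕ) : ℝ) * M μ ν (i' + 1) y')) +
            4 * (404 * ((((F.P K).d + 2) * (F.P K).L : ℕ) : ℝ) * α (i' + 1) * M μ ν (i' + 1) y') + 4 * R μ ν (i' + 1) y' +
            2 * δ (i' + 1) * (((F.P K).L : ℝ) ^ 2 * M μ ν (i' + 1) y')) +
          (if i' = 0 then ((Fintype.card (Idx (F.P K)) : ℝ)⁻¹ *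
            ∑ a ∈ (Finset.univ : Finset (Idx (F.P K))) ×ˢ (Finset.range (F.P K).L ×ˢ Finset.range (F.P K).L),
              (Real.exp (‖X i' ⟨(shiftN (shiftN (Site.blockSite y' a.1.1) μ a.2.1) ν a.2.2), μ⟩‖ + ‖X i' ⟨((shiftN (shiftN (Site.blockSite y' a.1.1) μ a.2.1) ν a.2.2)).shift μ, ν⟩‖ + ‖X i' ⟨((shiftN (shiftN (Site.blockSite y' a.1.1) μ a.2.1) ν a.2.2)).shift ν, μ⟩‖ + ‖X i' ⟨(shiftN (shiftN (Site.blockSite y' a.1.1) μ a.2.1) ν a.2.2), ν⟩‖) - 1 - (‖X i' ⟨(shiftN (shiftN (Site.blockSite y' a.1.1) μ a.2.1) ν a.2.2), μ⟩‖ + ‖X i' ⟨((shiftN (shiftN (Site.blockSite y' a.1.1) μ a.2.1) ν a.2.2)).shift μ, ν⟩‖ + ‖X i' ⟨((shiftN (shiftN (Site.blockSite y' a.1.1) μ a.2.1) ν a.2.2)).shift ν, μ⟩‖ + ‖X i' ⟨(shiftN (shiftN (Site.blockSite y' a.1.1) μ a.2.1) ν a.2.2), ν⟩‖))) else 0)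
          else 0) else 0
      : Fin (F.P K).d → Fin (F.P K).d → (i : ℕ) → Site (F.P K) i → ℝ) μ ν i x := by
    intro μ ν i x
    have hc0 : (0 : ℝ) ≤ (Fintype.card (Idx (F.P K)) : ℝ)⁻¹ := inv_nonneg.2 (Nat.cast_nonneg _)
    cases i with
    | zero => exact le_rfl
    | succ i' =>
      simp only
      split_ifs with hi' hμν h0
      · exact add_nonneg (srcM_nonneg (Nat.cast_nonneg _) (Nat.cast_nonneg _) (hδ i' hi') (hα0 _) (hαp0 μ ν _) (hM μ ν _ x) (hR0 μ ν _ x))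
          (mul_nonneg hc0 (Finset.sum_nonneg fun a _ => hrem _))
      · exact add_nonneg (srcM_nonneg (Nat.cast_nonneg _) (Nat.cast_nonneg _) (hδ i' hi') (hα0 _) (hαp0 μ ν _) (hM μ ν _ x) (hR0 μ ν _ x)) le_rfl
      · exact le_rfl
      · exact le_rfl
  have hdom : ∀ n, n < K - J → ∀ p : Plaq (F.P K) n,
      (fun (μ ν : Fin (F.P K).d) (i : ℕ) (x : Site (F.P K) i) =>
      (if h : μ < ν then (if i = 0 then dist1 ((GaugeField.plaqHol (Averaging.iter (fun k => BlockAveraging.blockAvg (P := F.P K) (j := k) ℰp) i U₀) ⟨x, μ, ν, h⟩)⁻¹ *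
          GaugeField.plaqHol (Averaging.iter (fun k => BlockAveraging.blockAvg (P := F.P K) (j := k) ℰp) i (fun ℓ => expPoint (ζ ℓ) * U₀ ℓ : GaugeField (F.P K) 0 (Matrix.specialUnitaryGroup (Fin 2) ℂ))) ⟨x, μ, ν, h⟩) else ‖covWalkSum (Averaging.iter (fun k => BlockAveraging.blockAvg (P := F.P K) (j := k) ℰp) i U₀) (fun b => ((X i b : (specialUnitaryLogChart (Fin 2)).lie) : Matrix (Fin 2) (Fin 2) ℂ))
          (walk x [((μ, true) : Letter (F.P K).d), (ν, true), (μ, false), (ν, false)])‖) else 0)) p.μ p.ν n p.src ≤ (fun (μ ν : Fin (F.P K).d) (i : ℕ) (x : Site (F.P K) i) =>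
      (if h : μ < ν then (if i = 0 then dist1 ((GaugeField.plaqHol (Averaging.iter (fun k => BlockAveraging.blockAvg (P := F.P K) (j := k) ℰp) i U₀) ⟨x, μ, ν, h⟩)⁻¹ *
          GaugeField.plaqHol (Averaging.iter (fun k => BlockAveraging.blockAvg (P := F.P K) (j := k) ℰp) i (fun ℓ => expPoint (ζ ℓ) * U₀ ℓ : GaugeField (F.P K) 0 (Matrix.specialUnitaryGroup (Fin 2) ℂ))) ⟨x, μ, ν, h⟩) else ‖covWalkSum (Averaging.iter (fun k => BlockAveraging.blockAvg (P := F.P K) (j := k) ℰp) i U₀) (fun b => ((X i b : (specialUnitaryLogChart (Fin 2)).lie) : Matrix (Fin 2) (Fin 2) ℂ))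
          (walk x [((μ, true) : Letter (F.P K).d), (ν, true), (μ, false), (ν, false)])‖) else 0)) p.μ p.ν n p.src := fun n _ p => le_rfl
  have hdom0 : ∀ p : Plaq (F.P K) 0, (fun (μ ν : Fin (F.P K).d) (i : ℕ) (x : Site (F.P K) i) =>
      (if h : μ < ν then (if i = 0 then dist1 ((GaugeField.plaqHol (Averaging.iter (fun k => BlockAveraging.blockAvg (P := F.P K) (j := k) ℰp) i U₀) ⟨x, μ, ν, h⟩)⁻¹ *
          GaugeField.plaqHol (Averaging.iter (fun k => BlockAveraging.blockAvg (P := F.P K) (j := k) ℰp) i (fun ℓ => expPoint (ζ ℓ) * U₀ ℓ : GaugeField (F.P K) 0 (Matrix.specialUnitaryGroup (Fin 2) ℂ))) ⟨x, μ, ν, h⟩) else ‖covWalkSum (Averaging.iter (fun k => BlockAveraging.blockAvg (P := F.P K) (j := k) ℰp) i U₀) (fun b => ((X i b : (specialUnitaryLogChart (Fin 2)).lie) : Matrix (Fin 2) (Fin 2) ℂ))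
          (walk x [((μ, true) : Letter (F.P K).d), (ν, true), (μ, false), (ν, false)])‖) else 0)) p.μ p.ν 0 p.src ≤
      dist1 ((GaugeField.plaqHol U₀ p)⁻¹ * GaugeField.plaqHol (fun ℓ => expPoint (ζ ℓ) * U₀ ℓ : GaugeField (F.P K) 0 (Matrix.specialUnitaryGroup (Fin 2) ℂ)) p) := by
    intro p
    beta_reduce
    rw [dif_pos p.hμν, if_pos rfl]
    exact le_rfl
  have hrows : ∀ μ ν : Fin (F.P K).d, μ < ν → ∀ i, i < K - J → ∀ y' : Site (F.P K) (i + 1),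
      (fun (μ ν : Fin (F.P K).d) (i : ℕ) (x : Site (F.P K) i) =>
      (if h : μ < ν then (if i = 0 then dist1 ((GaugeField.plaqHol (Averaging.iter (fun k => BlockAveraging.blockAvg (P := F.P K) (j := k) ℰp) i U₀) ⟨x, μ, ν, h⟩)⁻¹ *
          GaugeField.plaqHol (Averaging.iter (fun k => BlockAveraging.blockAvg (P := F.P K) (j := k) ℰp) i (fun ℓ => expPoint (ζ ℓ) * U₀ ℓ : GaugeField (F.P K) 0 (Matrix.specialUnitaryGroup (Fin 2) ℂ))) ⟨x, μ, ν, h⟩) else ‖covWalkSum (Averaging.iter (fun k => BlockAveraging.blockAvg (P := F.P K) (j := k) ℰp) i U₀) (fun b => ((X i b : (specialUnitaryLogChart (Fin 2)).lie) : Matrix (Fin 2) (Fin 2) ℂ))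
          (walk x [((μ, true) : Letter (F.P K).d), (ν, true), (μ, false), (ν, false)])‖) else 0)) μ ν (i + 1) y' ≤ ((1 : ℝ) + (fun _ : ℕ => (0 : ℝ)) i) * ((Fintype.card (Idx (F.P K)) : ℝ)⁻¹ *
            ∑ a ∈ (Finset.univ : Finset (Idx (F.P K))) ×ˢ (Finset.range (F.P K).L ×ˢ Finset.range (F.P K).L),
              (fun (μ ν : Fin (F.P K).d) (i : ℕ) (x : Site (F.P K) i) =>
      (if h : μ < ν then (if i = 0 then dist1 ((GaugeField.plaqHol (Averaging.iter (fun k => BlockAveraging.blockAvg (P := F.P K) (j := k) ℰp) i U₀) ⟨x, μ, ν, h⟩)⁻¹ *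
          GaugeField.plaqHol (Averaging.iter (fun k => BlockAveraging.blockAvg (P := F.P K) (j := k) ℰp) i (fun ℓ => expPoint (ζ ℓ) * U₀ ℓ : GaugeField (F.P K) 0 (Matrix.specialUnitaryGroup (Fin 2) ℂ))) ⟨x, μ, ν, h⟩) else ‖covWalkSum (Averaging.iter (fun k => BlockAveraging.blockAvg (P := F.P K) (j := k) ℰp) i U₀) (fun b => ((X i b : (specialUnitaryLogChart (Fin 2)).lie) : Matrix (Fin 2) (Fin 2) ℂ))
          (walk x [((μ, true) : Letter (F.P K).d), (ν, true), (μ, false), (ν, false)])‖) else 0)) μ ν i (shiftN (shiftN (Site.blockSite y' a.1.1) μ a.2.1) ν a.2.2)) +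
        (fun (μ ν : Fin (F.P K).d) (i : ℕ) =>
      match i with
        | 0 => fun (_ : Site (F.P K) 0) => (0 : ℝ)
        | i' + 1 => fun (y' : Site (F.P K) (i' + 1)) => if i' < K - J then (if μ < ν then
          (((F.P K).L : ℝ) * (((F.P K).L : ℝ) * (2 * δ (i' + 1) * (((F.P K).L : ℝ) + 2 * (F.P K).L + 2) * M μ ν (i' + 1) y')) + 48 * α (i' + 1) * (((F.P K).L : ℝ) * M μ ν (i' + 1) y') +
            (2 * αp μ ν (i' + 1) * (((((F.P K).d + 2) * (F.P K).L : ℕ) : ℝ) * M μ ν (i' + 1) y') + 24 * α (i' + 1) * (((((F.P K).d + 2) * (F.P K).L : ℕ) : ℝ) * M μ ν (i' + 1) y')) +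
            4 * (404 * ((((F.P K).d + 2) * (F.P K).L : ℕ) : ℝ) * α (i' + 1) * M μ ν (i' + 1) y') + 4 * R μ ν (i' + 1) y' +
            2 * δ (i' + 1) * (((F.P K).L : ℝ) ^ 2 * M μ ν (i' + 1) y')) +
          (if i' = 0 then ((Fintype.card (Idx (F.P K)) : ℝ)⁻¹ *
            ∑ a ∈ (Finset.univ : Finset (Idx (F.P K))) ×ˢ (Finset.range (F.P K).L ×ˢ Finset.range (F.P K).L),
              (Real.exp (‖X i' ⟨(shiftN (shiftN (Site.blockSite y' a.1.1) μ a.2.1) ν a.2.2), μ⟩‖ + ‖X i' ⟨((shiftN (shiftN (Site.blockSite y' a.1.1) μ a.2.1) ν a.2.2)).shift μ, ν⟩‖ + ‖X i' ⟨((shiftN (shiftN (Site.blockSite y' a.1.1) μ a.2.1) ν a.2.2)).shift ν, μ⟩‖ + ‖X i' ⟨(shiftN (shiftN (Site.blockSite y' a.1.1) μ a.2.1) ν a.2.2), ν⟩‖) - 1 - (‖X i' ⟨(shiftN (shiftN (Site.blockSite y' a.1.1) μ a.2.1) ν a.2.2), μ⟩‖ + ‖X i' ⟨((shiftN (shiftN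 (Site.blockSite y' a.1.1) μ a.2.1) ν a.2.2)).shift μ, ν⟩‖ + ‖X i' ⟨((shiftN (shiftN (Site.blockSite y' a.1.1) μ a.2.1) ν a.2.2)).shift ν, μ⟩‖ + ‖X i' ⟨(shiftN (shiftN (Site.blockSite y' a.1.1) μ a.2.1) ν a.2.2), ν⟩‖))) else 0)
          else 0) else 0
      : Fin (F.P K).d → Fin (F.P K).d → (i : ℕ) → Site (F.P K) i → ℝ) μ ν (i + 1) y' := by
    intro μ ν hμν i hi y'
    have hlin := hrowlin μ ν hμν i hi y'
    have hc0 : (0 : ℝ) ≤ (Fintype.card (Idx (F.P K)) : ℝ)⁻¹ := inv_nonneg.2 (Nat.cast_nonneg _)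
    beta_reduce
    simp only [dif_pos hμν, Nat.succ_ne_zero, if_false, add_zero, one_mul]
    rw [if_pos hi, if_pos hμν]
    by_cases h0 : i = 0
    · subst h0
      simp only [if_true]
      -- level 0 → 1: the mirror junction `lin₀ ≤ d₀ + rem₀` pointwise under the dilution mean
      have hpt : ∀ x : Site (F.P K) 0, ‖covWalkSum (Averaging.iter (fun k => BlockAveraging.blockAvg (P := F.P K) (j := k) ℰp) 0 U₀) (fun b => ((X 0 b : (specialUnitaryLogChart (Fin 2)).lie) : Matrix (Fin 2) (Fin 2) ℂ))
          (walk x [((μ, true) : Letter (F.P K).d), (ν, true), (μ, false), (ν, false)])‖ ≤ dist1 ((GaugeField.plaqHol (Averaging.iter (fun k => BlockAveraging.blockAvg (P := F.P K) (j := k) ℰp) 0 U₀) ⟨x, μ, ν, hμν⟩)⁻¹ *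
          GaugeField.plaqHol (Averaging.iter (fun k => BlockAveraging.blockAvg (P := F.P K) (j := k) ℰp) 0 (fun ℓ => expPoint (ζ ℓ) * U₀ ℓ : GaugeField (F.P K) 0 (Matrix.specialUnitaryGroup (Fin 2) ℂ))) ⟨x, μ, ν, hμν⟩) + (Real.exp (‖X 0 ⟨x, μ⟩‖ + ‖X 0 ⟨(x).shift μ, ν⟩‖ + ‖X 0 ⟨(x).shift ν, μ⟩‖ + ‖X 0 ⟨x, ν⟩‖) - 1 - (‖X 0 ⟨x, μ⟩‖ + ‖X 0 ⟨(x).shift μ, ν⟩‖ + ‖X 0 ⟨(x).shift ν, μ⟩‖ + ‖X 0 ⟨x, ν⟩‖)) := by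
        intro x
        have hj := norm_curl_le_dist1_relPlaq_add_rem (P := F.P K) (N := 2) (Averaging.iter (fun k => BlockAveraging.blockAvg (P := F.P K) (j := k) ℰp) 0 U₀) (X 0) x hμν
        rw [← hstage 0] at hj
        exact hj
      have hsum := Finset.sum_le_sum fun a (_ : a ∈ (Finset.univ : Finset (Idx (F.P K))) ×ˢ (Finset.range (F.P K).L ×ˢ Finset.range (F.P K).L)) =>
        hpt (shiftN (shiftN (Site.blockSite y' a.1.1) μ a.2.1) ν a.2.2)
      rw [Finset.sum_add_distrib] at hsum
      have hmul := mul_le_mul_of_nonneg_left hsum hc0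
      rw [mul_add] at hmul
      linarith
    · simp only [h0, if_false, add_zero]
      exact hlin
  -- (5) the source energy, re-indexed from rows `i ↦ i + 1` to levels `j ∈ Icc 1 (K − J)`
  have hBsrc' : ∑ j ∈ Finset.Icc 1 (K - J), w j * (F.L : ℝ) ^ (K - J - 1 - j) *
      ∑ μ : Fin (F.P K).d, ∑ ν : Fin (F.P K).d, ∑ c : Site (F.P K) j, (fun (μ ν : Fin (F.P K).d) (i : ℕ) =>
      match i with
        | 0 => fun (_ : Site (F.P K) 0) => (0 : ℝ)
        | i' + 1 => fun (y' : Site (F.P K) (i' + 1)) => if i' < K - J then (if μ < ν then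
          (((F.P K).L : ℝ) * (((F.P K).L : ℝ) * (2 * δ (i' + 1) * (((F.P K).L : ℝ) + 2 * (F.P K).L + 2) * M μ ν (i' + 1) y')) + 48 * α (i' + 1) * (((F.P K).L : ℝ) * M μ ν (i' + 1) y') +
            (2 * αp μ ν (i' + 1) * (((((F.P K).d + 2) * (F.P K).L : ℕ) : ℝ) * M μ ν (i' + 1) y') + 24 * α (i' + 1) * (((((F.P K).d + 2) * (F.P K).L : ℕ) : ℝ) * M μ ν (i' + 1) y')) +
            4 * (404 * ((((F.P K).d + 2) * (F.P K).L : ℕ) : ℝ) * α (i' + 1) * M μ ν (i' + 1) y') + 4 * R μ ν (i' + 1) y' +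
            2 * δ (i' + 1) * (((F.P K).L : ℝ) ^ 2 * M μ ν (i' + 1) y')) +
          (if i' = 0 then ((Fintype.card (Idx (F.P K)) : ℝ)⁻¹ *
            ∑ a ∈ (Finset.univ : Finset (Idx (F.P K))) ×ˢ (Finset.range (F.P K).L ×ˢ Finset.range (F.P K).L),
              (Real.exp (‖X i' ⟨(shiftN (shiftN (Site.blockSite y' a.1.1) μ a.2.1) ν a.2.2), μ⟩‖ + ‖X i' ⟨((shiftN (shiftN (Site.blockSite y' a.1.1) μ a.2.1) ν a.2.2)).shift μ, ν⟩‖ + ‖X i' ⟨((shiftN (shiftN (Site.blockSite y' a.1.1) μ a.2.1) ν a.2.2)).shift ν, μ⟩‖ + ‖X i' ⟨(shiftN (shiftN (Site.blockSite y' a.1.1) μ a.2.1) ν a.2.2), ν⟩‖) - 1 - (‖X i' ⟨(shiftN (shiftN (Site.blockSite y' a.1.1) μ a.2.1) ν a.2.2), μ⟩‖ + ‖X i' ⟨((shiftN (shiftN (Site.blockSite y' a.1.1) μ a.2.1) ν a.2.2)).shift μ, ν⟩‖ + ‖X i' ⟨((shiftN (shiftN (Site.blockSite y' a.1.1) μ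 a.2.1) ν a.2.2)).shift ν, μ⟩‖ + ‖X i' ⟨(shiftN (shiftN (Site.blockSite y' a.1.1) μ a.2.1) ν a.2.2), ν⟩‖))) else 0)
          else 0) else 0
      : Fin (F.P K).d → Fin (F.P K).d → (i : ℕ) → Site (F.P K) i → ℝ) μ ν j c ^ 2 ≤ Bsrc := by
    have e : ∀ gj : ℕ → ℝ, ∑ j ∈ Finset.Icc 1 (K - J), gj j = ∑ i ∈ Finset.range (K - J), gj (i + 1) := by
      intro gj
      rw [Finset.range_eq_Ico, Finset.sum_Ico_add' gj 0 (K - J) 1, zero_add, Finset.Ico_add_one_right_eq_Icc]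
    rw [e]
    refine le_of_eq_of_le ?_ hBsrc
    refine Finset.sum_congr rfl fun i hi => ?_
    rw [Finset.mem_range] at hi
    congr 1
    refine Finset.sum_congr rfl fun μ _ => Finset.sum_congr rfl fun ν _ => Finset.sum_congr rfl fun y' _ => ?_
    simp only [if_pos hi]
  -- (6) the core
  have key := curlBudget_core_abs F hJK θr Cst hCst U₀ ζ
    (fun (n : ℕ) (p : Plaq (F.P K) n) => (fun (μ ν : Fin (F.P K).d) (i : ℕ) (x : Site (F.P K) i) =>
      (if h : μ < ν then (if i = 0 then dist1 ((GaugeField.plaqHol (Averaging.iter (fun k => BlockAveraging.blockAvg (P := F.P K) (j := k) ℰp) i U₀) ⟨x, μ, ν, h⟩)⁻¹ *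
          GaugeField.plaqHol (Averaging.iter (fun k => BlockAveraging.blockAvg (P := F.P K) (j := k) ℰp) i (fun ℓ => expPoint (ζ ℓ) * U₀ ℓ : GaugeField (F.P K) 0 (Matrix.specialUnitaryGroup (Fin 2) ℂ))) ⟨x, μ, ν, h⟩) else ‖covWalkSum (Averaging.iter (fun k => BlockAveraging.blockAvg (P := F.P K) (j := k) ℰp) i U₀) (fun b => ((X i b : (specialUnitaryLogChart (Fin 2)).lie) : Matrix (Fin 2) (Fin 2) ℂ))
          (walk x [((μ, true) : Letter (F.P K).d), (ν, true), (μ, false), (ν, false)])‖) else 0)) p.μ p.ν n p.src) (fun n p => hρ0 p.μ p.ν n p.src)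
    w hw W hW
    (fun (μ ν : Fin (F.P K).d) (i : ℕ) (x : Site (F.P K) i) =>
      (if h : μ < ν then (if i = 0 then dist1 ((GaugeField.plaqHol (Averaging.iter (fun k => BlockAveraging.blockAvg (P := F.P K) (j := k) ℰp) i U₀) ⟨x, μ, ν, h⟩)⁻¹ *
          GaugeField.plaqHol (Averaging.iter (fun k => BlockAveraging.blockAvg (P := F.P K) (j := k) ℰp) i (fun ℓ => expPoint (ζ ℓ) * U₀ ℓ : GaugeField (F.P K) 0 (Matrix.specialUnitaryGroup (Fin 2) ℂ))) ⟨x, μ, ν, h⟩) else ‖covWalkSum (Averaging.iter (fun k => BlockAveraging.blockAvg (P := F.P K) (j := k) ℰp) i U₀) (fun b => ((X i b : (specialUnitaryLogChart (Fin 2)).lie) : Matrix (Fin 2) (Fin 2) ℂ))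
          (walk x [((μ, true) : Letter (F.P K).d), (ν, true), (μ, false), (ν, false)])‖) else 0))
    (fun (μ ν : Fin (F.P K).d) (i : ℕ) =>
      match i with
        | 0 => fun (_ : Site (F.P K) 0) => (0 : ℝ)
        | i' + 1 => fun (y' : Site (F.P K) (i' + 1)) => if i' < K - J then (if μ < ν then
          (((F.P K).L : ℝ) * (((F.P K).L : ℝ) * (2 * δ (i' + 1) * (((F.P K).L : ℝ) + 2 * (F.P K).L + 2) * M μ ν (i' + 1) y')) + 48 * α (i' + 1) * (((F.P K).L : ℝ) * M μ ν (i' + 1) y') +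
            (2 * αp μ ν (i' + 1) * (((((F.P K).d + 2) * (F.P K).L : ℕ) : ℝ) * M μ ν (i' + 1) y') + 24 * α (i' + 1) * (((((F.P K).d + 2) * (F.P K).L : ℕ) : ℝ) * M μ ν (i' + 1) y')) +
            4 * (404 * ((((F.P K).d + 2) * (F.P K).L : ℕ) : ℝ) * α (i' + 1) * M μ ν (i' + 1) y') + 4 * R μ ν (i' + 1) y' +
            2 * δ (i' + 1) * (((F.P K).L : ℝ) ^ 2 * M μ ν (i' + 1) y')) +
          (if i' = 0 then ((Fintype.card (Idx (F.P K)) : ℝ)⁻¹ *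
            ∑ a ∈ (Finset.univ : Finset (Idx (F.P K))) ×ˢ (Finset.range (F.P K).L ×ˢ Finset.range (F.P K).L),
              (Real.exp (‖X i' ⟨(shiftN (shiftN (Site.blockSite y' a.1.1) μ a.2.1) ν a.2.2), μ⟩‖ + ‖X i' ⟨((shiftN (shiftN (Site.blockSite y' a.1.1) μ a.2.1) ν a.2.2)).shift μ, ν⟩‖ + ‖X i' ⟨((shiftN (shiftN (Site.blockSite y' a.1.1) μ a.2.1) ν a.2.2)).shift ν, μ⟩‖ + ‖X i' ⟨(shiftN (shiftN (Site.blockSite y' a.1.1) μ a.2.1) ν a.2.2), ν⟩‖) - 1 - (‖X i' ⟨(shiftN (shiftN (Site.blockSite y' a.1.1) μ a.2.1) ν a.2.2), μ⟩‖ + ‖X i' ⟨((shiftN (shiftN (Site.blockSite y' a.1.1) μ a.2.1) ν a.2.2)).shift μ, ν⟩‖ + ‖X i' ⟨((shiftN (shiftN (Site.blockSite y' a.1.1) μ a.2.1) ν a.2.2)).shift ν, μ⟩‖ + ‖X i' ⟨(shiftN (shiftN (Site.blockSite y' a.1.1) μ a.2.1) ν a.2.2), ν⟩‖))) else 0)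
          else 0) else 0
      : Fin (F.P K).d → Fin (F.P K).d → (i : ℕ) → Site (F.P K) i → ℝ)
    (fun _ => 0) hρ0 hsrc0 (fun _ => le_rfl) hdom hdom0 hrows 0 (by simp) Bsrc hBsrc'
  rw [Real.exp_zero, one_mul] at key
  exact key

end Summit.QuantumFields.YangMills.Theorems.FluctuationComparisonRegPrIntLS2BetaCurlBudgetOfChartTowerSup

end
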